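import Literature.ModelTheory.FiniteModelTheory.CFI
import Literature.ModelTheory.FiniteModelTheory.CkEquiv
import Literature.ModelTheory.FiniteModelTheory.CapturingPTIME
import Literature.Combinatorics.SimpleGraph.TreeDecomposition
import HarnessLib

/-!
# The uncoloured Cai–Fürer–Immerman graphs: non-isomorphism, tree-width and `C^k`, P-time separation (Chen–Flum–Liu 2025)

Topic `Literature/ModelTheory/FiniteModelTheory`. Named facts (D-0014) over EXISTING declarations:
the tree's UNCOLOURED CFI graphs `cfiGraph G T` / `cfiEven G = cfiGraph G ∅` (`CFI.lean`), the
bijective-pebble-game equivalence `CkEquiv k` (`CkEquiv.lean`), the tree's `treewidth`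
(`Combinatorics/SimpleGraph/TreeDecomposition.lean`) and `IsPTIMEClass` (`CapturingPTIME.lean`).
They ground the sanity facts about the query `cfiQuery` of route PneNP/Descriptive (crux
`Summit.PneNP.PneNP.Theses.Descriptive.DescriptiveCfiNotCpt`, stmt-PneNP-11105), whose CFI graphs
are uncoloured and unordered: `CFI.lean` records that "facts about this query (parity determines
the isomorphism type for connected `G`; even ≇ odd; polynomial-time decidability;
non-definability in FO(LFP)+C) must carry the hypotheses under which the cited proofs apply to
the uncoloured graphs", and `CountingWidthParameter.caiFurerImmerman_cfiEquiv` (CFI 1992 Thm 6.4,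
game form, PROVED in the tree) explicitly leaves out the NON-isomorphism of the even and the odd
graph, which Cai–Fürer–Immerman prove with colours. The source below treats exactly the graphs
obtained from the original CFI graphs by forgetting the colours.

Source read (this session, materialised `paper:arxiv-2507.01459`, pp. 1–5, 25–27, 37, 42–43,
52, 55): Y. Chen, J. Flum, M. Liu, *Some remarks on the uncolored versions of the original
CFI-graphs*, arXiv:2507.01459 (2025). Verbatim:

* §3 (3.1): the uncoloured gadget `Y(d)` has vertices `A(d) ∪ B(d) ∪ M(d)`,
  `M(d) = {m ⊆ A(d) | |m| even}`, edges `am (a ∈ m)` and `a′m (a ∉ m)` — the tree's gadget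
  (`CFI.lean`: `m_{u,S} — a_{u,w}` for `w ∈ S`, `m_{u,S} — b_{u,w}` for `w ∉ S`); §6: gadgets are
  joined along the edges of `G` by `a(u,v)a(v,u)`, `b(u,v)b(v,u)` (untwisted) resp.
  `a(u,v)b(v,u)`, `b(u,v)a(v,u)` (twisted) (p. 58), as in `cfiGraph G T`; "we always assume that
  `G` is a connected graph" (p. 16) "with at least two vertices" (p. 26); Def. 6.6:
  "`Ỹ(G) := Y^e(G)`" for "an arbitrary edge `e ∈ E(G)`", well defined up to isomorphism by
  Cor. 6.3; Lemma 6.5: "`X^ē(G) ≅ X(G)` if `|ē|` is even and `X^ē(G) ≅ X̃(G)` if `|ē|` is odd"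
  (also uncoloured, p. 16).
* Cor. 7.11: "For all graphs `G`, `Y(G) ≇ Ỹ(G)`."
* Thm. 8.1: "There is a polynomial time algorithm accepting (all graphs isomorphic to) `Y(G)` for
  all `G` and rejecting the corresponding `Ỹ(G)`." ("the algorithm does not know whether the input
  graph is a `Y(G)` or a `Ỹ(G)` and in the positive case it does not have information on the
  corresponding `G`"; on other inputs its behaviour is unconstrained, p. 26–27.)
* Thm. 11.1: "Let `k ≥ 1` and `G` a graph. If `tw(G) ≥ k`, then `X(G) ≡_{C^k} X̃(G)`", whence
  (12.1) "`tw(G) ≥ k` implies `Y(G) ≡_{C^k} Ỹ(G)`" ("Dawar and Richerby proved this result under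
  the additional assumption that every vertex of `G` has at least degree 2").
* Cor. 12.3: "Assume `k ≥ 2`. If `tw(G) < k`, then `Y(G) ≢_{C^k} Ỹ(G)`" (via Dvořák's theorem,
  Thm. 12.1, and `hom(G₂, Y(G)) > hom(G₂, Ỹ(G))`, Thm. 12.2); together "`tw(G) ≥ k ⟺
  Y(G) ≡_{C^k} Ỹ(G)`" (p. 39).
* Prop. 10.5: `≡_{C^k}` is Hella's bijective `k`-pebble game — the tree's `CkEquiv k`.

## Rendering

`Y(G) = cfiEven G`, `Ỹ(G) = cfiGraph G {e}` for an edge `e` of `G` (Def. 6.6; any edge, Cor. 6.3);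
the standing hypotheses "connected, at least two vertices" are carried explicitly
(`G.Connected`, `2 ≤ v`); `tw` is the tree's `treewidth` (minimum width of a tree
decomposition, §11 p. 36 verbatim the same definition); "polynomial time algorithm accepting …
rejecting …" is rendered by an `IsPTIMEClass` class of finite graphs (codes decidable in `P`,
`CapturingPTIME.lean`) containing every graph isomorphic to some `Y(G)` and no graph isomorphic
to some `Ỹ(G)` (the algorithm of §8 reads the abstract graph: degrees, short cycles, gadgets).

## What is NOT vendored

§5 (automorphisms of `Y(d)`, `d ∉ {1,2,4}`), Thm. 7.4 / Prop. 7.10 (structure of `Aut(Y(G))` for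
`deg(G) ≥ 3`), §9 (first-order definability of "same colour"), §10 (`L^k` versus `C^k`), §13
(coNP-hardness of `L^k`-equivalence); and the RECOGNITION of CFI graphs among all graphs
(membership of the tree's `cfiQuery` in `P`), which the paper does not state.

## References

* [ChenFlumLiu2025] Y. Chen, J. Flum, M. Liu, *Some remarks on the uncolored versions of the
  original CFI-graphs*, arXiv:2507.01459 (2025): §3 (3.1), §6 Def. 6.6, Lemma 6.5, Cor. 6.3,
  Cor. 7.11, Thm. 8.1, Prop. 10.5, Thm. 11.1, (12.1), Thm. 12.1, Thm. 12.2, Cor. 12.3.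
* [CaiFurerImmerman1992] J.-Y. Cai, M. Fürer, N. Immerman, Combinatorica 12 (1992), §6
  (Lemma 6.2, Thm. 6.4) — the coloured originals.
* [DawarRicherby2007] A. Dawar, D. Richerby, *The power of counting logics on restricted classes
  of finite structures*, CSL 2007 (tree-width form for coloured CFI graphs, min. degree ≥ 2).
* [Dvorak2010] Z. Dvořák, J. Graph Theory 64 (2010), Thm. 6 (used in Cor. 12.3).
-/

namespace Literature.ModelTheory.FiniteModelTheory

open Literature.Combinatorics.SimpleGraph

/-- **Chen–Flum–Liu 2025, Cor. 7.11: the uncoloured even and odd CFI graphs are not isomorphic.**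
"For all graphs `G`, `Y(G) ≇ Ỹ(G)`" — for every connected base graph `G` with at least two
vertices (standing assumption, pp. 16, 26) and every edge `e` of `G` (`Ỹ(G) := Y^e(G)`,
Def. 6.6), the uncoloured CFI graph with no twisted edge and the one with the single twisted edge
`e` are not isomorphic. Rendering: `Y(G) = cfiEven G`, `Y^e(G) = cfiGraph G {e}` (`CFI.lean`).
Complements `caiFurerImmerman_cfiEquiv` (CFI 1992 Thm. 6.4, game form, which leaves
non-isomorphism out). Grounds the sanity of `cfiQuery` for
`Summit.PneNP.PneNP.Theses.Descriptive.DescriptiveCfiNotCpt`.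
[cite: ChenFlumLiu2025, Cor. 7.11 (with Def. 6.6, Cor. 6.3)] -/
def ChenFlumLiu2025_cfiEven_not_iso_cfiOdd : Prop :=
  ∀ (v : ℕ) (G : SimpleGraph (Fin v)) [DecidableRel G.Adj],
    G.Connected → 2 ≤ v →
    ∀ e ∈ G.edgeSet, ∀ [DecidablePred (· ∈ ({e} : Set (Sym2 (Fin v))))],
      IsEmpty (cfiEven G ≃g cfiGraph G ({e} : Set (Sym2 (Fin v))))

/-- **Chen–Flum–Liu 2025, Thm. 11.1 / (12.1): large tree-width makes the uncoloured even and odd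
CFI graphs `C^k`-equivalent.** "Let `k ≥ 1` and `G` a graph. If `tw(G) ≥ k`, then
`X(G) ≡_{C^k} X̃(G)`", hence "(12.1) `tw(G) ≥ k` implies `Y(G) ≡_{C^k} Ỹ(G)`" (forgetting colours).
Rendering: `G` connected with at least two vertices (standing assumption), `tw` = the tree's
`treewidth`, `≡_{C^k}` = `CkEquiv k` (bijective `k`-pebble game, Prop. 10.5), `Ỹ(G) = cfiGraph G
{e}` for an edge `e`. Sharpens the separator form `caiFurerImmerman_cfiEquiv` and drops
Dawar–Richerby's minimum-degree-2 hypothesis. [cite: ChenFlumLiu2025, Thm. 11.1 and (12.1)] -/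
def ChenFlumLiu2025_ckEquiv_of_le_treewidth : Prop :=
  ∀ (v k : ℕ) (G : SimpleGraph (Fin v)) [DecidableRel G.Adj],
    G.Connected → 2 ≤ v → 1 ≤ k → k ≤ treewidth G →
    ∀ e ∈ G.edgeSet, ∀ [DecidablePred (· ∈ ({e} : Set (Sym2 (Fin v))))],
      CkEquiv k (cfiEven G) (cfiGraph G ({e} : Set (Sym2 (Fin v))))

/-- **Chen–Flum–Liu 2025, Cor. 12.3: small tree-width lets `C^k` separate them.** "Assume
`k ≥ 2`. If `tw(G) < k`, then `Y(G) ≢_{C^k} Ỹ(G)`" (adapting Roberson's proof: Dvořák's theorem,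
Thm. 12.1, and `hom(G₂, Y(G)) > hom(G₂, Ỹ(G))` for the 2-subdivision `G₂`, Thm. 12.2). With the
previous fact: `tw(G) ≥ k ⟺ Y(G) ≡_{C^k} Ỹ(G)` (p. 39). Same rendering.
[cite: ChenFlumLiu2025, Cor. 12.3 (with Thm. 12.1, Thm. 12.2)] -/
def ChenFlumLiu2025_not_ckEquiv_of_treewidth_lt : Prop :=
  ∀ (v k : ℕ) (G : SimpleGraph (Fin v)) [DecidableRel G.Adj],
    G.Connected → 2 ≤ v → 2 ≤ k → treewidth G < k →
    ∀ e ∈ G.edgeSet, ∀ [DecidablePred (· ∈ ({e} : Set (Sym2 (Fin v))))],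
      ¬ CkEquiv k (cfiEven G) (cfiGraph G ({e} : Set (Sym2 (Fin v))))

/-- **Chen–Flum–Liu 2025, Thm. 8.1: even and odd uncoloured CFI graphs are separated in
polynomial time.** "There is a polynomial time algorithm accepting (all graphs isomorphic to)
`Y(G)` for all `G` and rejecting the corresponding `Ỹ(G)`" ("the algorithm does not know whether
the input graph is a `Y(G)` or a `Ỹ(G)` and in the positive case it does not have information on
the corresponding `G`"; behaviour on other inputs unconstrained). Rendering: a class `C` of
finite graphs whose language of codes is in `P` (`IsPTIMEClass`, `CapturingPTIME.lean`) that
contains every finite graph (on some `Fin n`) isomorphic to `cfiEven G` and none isomorphic to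
`cfiGraph G {e}`, for all connected `G` on `Fin v`, `v ≥ 2`, and edges `e` of `G`. This is the
promise version; recognising CFI graphs among all graphs (the tree's `cfiQuery ∈ P`) is not
asserted. [cite: ChenFlumLiu2025, Thm. 8.1] -/
def ChenFlumLiu2025_ptime_separation : Prop :=
  ∃ C : Set FinGraph, IsPTIMEClass C ∧
    ∀ (v : ℕ) (G : SimpleGraph (Fin v)) [DecidableRel G.Adj], G.Connected → 2 ≤ v →
      (∀ H : FinGraph, Nonempty (H.2 ≃g cfiEven G) → H ∈ C) ∧
      ∀ e ∈ G.edgeSet, ∀ [DecidablePred (· ∈ ({e} : Set (Sym2 (Fin v))))],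
        ∀ H : FinGraph, Nonempty (H.2 ≃g cfiGraph G ({e} : Set (Sym2 (Fin v)))) → H ∉ C

/-! ### Consequences -/

/-- The odd one-twist CFI graph over a connected base with an edge is not an EVEN CFI graph over
the same base presented by the empty twist set: unfolding of Cor. 7.11 in the `Nonempty` form used
by `IsEvenCFIOf`. [cite: ChenFlumLiu2025, Cor. 7.11] -/
theorem ChenFlumLiu2025_cfiEven_not_iso_cfiOdd.not_nonempty
    (h : ChenFlumLiu2025_cfiEven_not_iso_cfiOdd) {v : ℕ} (G : SimpleGraph (Fin v))
    [DecidableRel G.Adj] (hc : G.Connected) (hv : 2 ≤ v) {e : Sym2 (Fin v)} (he : e ∈ G.edgeSet)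
    [DecidablePred (· ∈ ({e} : Set (Sym2 (Fin v))))] :
    ¬ Nonempty (cfiEven G ≃g cfiGraph G ({e} : Set (Sym2 (Fin v)))) := by
  rw [not_nonempty_iff]
  exact h v G hc hv e he

/-- The tree-width characterisation of `C^k`-equivalence of the uncoloured CFI pair, `k ≥ 2`
("`tw(G) ≥ k ⟺ Y(G) ≡_{C^k} Ỹ(G)`", p. 39), assembled from the two facts.
[cite: ChenFlumLiu2025, (12.1) and Cor. 12.3] -/
theorem ckEquiv_cfi_iff_le_treewidth (h₁ : ChenFlumLiu2025_ckEquiv_of_le_treewidth)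
    (h₂ : ChenFlumLiu2025_not_ckEquiv_of_treewidth_lt) {v k : ℕ} (G : SimpleGraph (Fin v))
    [DecidableRel G.Adj] (hc : G.Connected) (hv : 2 ≤ v) (hk : 2 ≤ k) {e : Sym2 (Fin v)}
    (he : e ∈ G.edgeSet) [DecidablePred (· ∈ ({e} : Set (Sym2 (Fin v))))] :
    CkEquiv k (cfiEven G) (cfiGraph G ({e} : Set (Sym2 (Fin v)))) ↔ k ≤ treewidth G := by
  constructor
  · intro hk'
    by_contra hlt
    exact h₂ v k G hc hv hk (lt_of_not_ge hlt) e he hk'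
  · intro hle
    exact h₁ v k G hc hv (le_trans (by norm_num) hk) hle e he

end Literature.ModelTheory.FiniteModelTheory
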